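import Literature.MathematicalPhysics.QuantumManyBody.PeriodicMaxFormBound
import HarnessLib

/-!
# The periodic Bose `C¹` core is a form core of the maximal form (integrable interaction)

Topic `Literature/MathematicalPhysics/QuantumManyBody`, sequel of `PeriodicMaxFormBound.lean`. For `L > 0`,
a measurable profile `w` with `∫_{[0,L)^{3N}} W < ∞` (`W = ∑_{i<j} w^per(xᵢ - xⱼ)`) and the maximal form
`Q_w(η) = ∑ₙ (∑ₚ (2πnₚ/L)²) |⟪eₙ, η⟫|² + ∫ (W ∘ fromUnitTorusN L)|η|²` on `L²((ℝ/ℤ)^{3N})` (Haar probability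
measure, Bose sector = Bose-symmetric Fourier coefficients):

* `tendsto_clampLp` — the clamp truncations `clampC k ∘ η` converge to `η` in `L²`;
* `exists_symm_trigPoly_maxForm_approx_general` — every Bose-symmetric `η` is the `L²`-limit of
  Bose-symmetric trigonometric polynomials `P` with `Q_w(P) ≤ Q_w(η) + ε` (kinetic part not larger, potential
  part up to `ε`);
* `exists_trialState_maxForm_approx` — **MaxFormApproximation**: for a UNIT Bose-symmetric `η` with
  `Q_w(η) < ∞` and `ε > 0` there is a periodic `C¹` Bose trial state `Φ` with
  `periodicEnergy w Φ ≤ Q_w(η) + ε` and `‖ι(graphEmbed Φ) - η‖ ≤ ε` (any auxiliary admissible embedding `ι`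
  of `PeriodicFormDomain`), i.e. the normalised `C¹` core is dense in the unit sphere of the maximal form
  domain for the form norm — B. Simon's theorem "maximal form = minimal form" for `W ∈ L¹`
  (*J. Operator Theory* 1 (1979) 37–47, Thm. 2.1; Kato) in the Bose sector of the torus. This is the
  hypothesis `hcore` of `…HardCoreExtensionTruncationReduction.stub_truncationCompactness_of_maxFormApproximation`
  in the integrable case (hard cores are NOT covered).

## References

* B. Simon, *Maximal and minimal Schrödinger forms*, J. Operator Theory 1 (1979) 37–47, Thm. 2.1.
* [ReedSimonIV1978] Reed–Simon IV, Thm. XIII.64; [ReedSimonI1980] §VIII.6 (form cores).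
-/

noncomputable section

open MeasureTheory Filter Set Complex UnitAddTorus
open scoped ENNReal NNReal Topology InnerProductSpace
open Literature.Analysis.FunctionSpaces Literature.Analysis.OperatorTheory

namespace Literature.MathematicalPhysics.QuantumManyBody.BoseGas

-- The measure on `ℝ/ℤ` is the Haar PROBABILITY measure, as in `PeriodicFormDomain.lean`.
attribute [local instance] formDomain_measureSpace formDomain_isProbabilityMeasure formDomain_isProbabilityMeasure_pi

variable {N : ℕ} {L : ℝ}

/-- Local notation for the Hilbert space `L²((ℝ/ℤ)^{3N})`, as in `PeriodicFormDomain.lean`. -/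
local notation "L2T " N':max => Lp ℂ 2 (volume : Measure (UnitAddTorus (Fin N' × Fin 3)))

/-! ### The clamp truncations converge in `L²` -/

/-- **`clampC k ∘ η → η` in `L²((ℝ/ℤ)^{3N})`** (dominated convergence: `‖clampC k z - z‖ ≤ 2‖z‖`, and the
sequence is eventually constant pointwise). [folklore] -/
theorem tendsto_clampLp (η : L2T N) :
    Tendsto (fun k : ℕ => ((lipschitzWith_clampC (k : ℝ)).compLp (clampC_zero (Nat.cast_nonneg k)) η : L2T N))
      atTop (𝓝 η) := by
  rw [Lp.tendsto_Lp_iff_tendsto_eLpNorm']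
  have hcoe : ∀ᵐ t ∂(volume : Measure (UnitAddTorus (Fin N × Fin 3))), ∀ k : ℕ,
      (((lipschitzWith_clampC (k : ℝ)).compLp (clampC_zero (Nat.cast_nonneg k)) η : L2T N) :
        UnitAddTorus (Fin N × Fin 3) → ℂ) t = clampC k ((η : UnitAddTorus (Fin N × Fin 3) → ℂ) t) :=
    ae_all_iff.2 fun k => ((lipschitzWith_clampC (k : ℝ)).coeFn_compLp (clampC_zero (Nat.cast_nonneg k)) η).mono
      fun t ht => by rw [ht, Function.comp_apply]
  -- the squared integrals tend to `0`
  have hlin : Tendsto (fun k : ℕ => ∫⁻ t, ‖((((lipschitzWith_clampC (k : ℝ)).compLp (clampC_zero (Nat.cast_nonneg k)) η :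
      L2T N) : UnitAddTorus (Fin N × Fin 3) → ℂ) - (η : UnitAddTorus (Fin N × Fin 3) → ℂ)) t‖ₑ ^ (2 : ℝ)) atTop
      (𝓝 0) := by
    have h := tendsto_lintegral_of_dominated_convergence'
      (F := fun (k : ℕ) t => ‖((((lipschitzWith_clampC (k : ℝ)).compLp (clampC_zero (Nat.cast_nonneg k)) η :
        L2T N) : UnitAddTorus (Fin N × Fin 3) → ℂ) - (η : UnitAddTorus (Fin N × Fin 3) → ℂ)) t‖ₑ ^ (2 : ℝ))
      (f := fun _ => 0) (fun t => ENNReal.ofReal 4 * ((‖(η : UnitAddTorus (Fin N × Fin 3) → ℂ) t‖₊ : ℝ≥0∞)) ^ 2)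
      (fun k => (((Lp.aestronglyMeasurable _).sub (Lp.aestronglyMeasurable η)).aemeasurable.enorm.pow_const _)) ?_ ?_ ?_
    · simpa using h
    · intro k
      filter_upwards [hcoe] with t ht
      rw [Pi.sub_apply, ht k, enorm_rpow_two_eq_coe_nnnorm_sq, coe_nnnorm_sq_eq_ofReal, coe_nnnorm_sq_eq_ofReal,
        ← ENNReal.ofReal_mul (by norm_num)]
      refine ENNReal.ofReal_le_ofReal ?_
      have h1 : ‖clampC k ((η : UnitAddTorus (Fin N × Fin 3) → ℂ) t) - (η : UnitAddTorus (Fin N × Fin 3) → ℂ) t‖ ≤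
          2 * ‖(η : UnitAddTorus (Fin N × Fin 3) → ℂ) t‖ :=
        (norm_sub_le _ _).trans (by linarith [norm_clampC_le_norm (Nat.cast_nonneg k) ((η : UnitAddTorus (Fin N × Fin 3) → ℂ) t)])
      nlinarith [norm_nonneg (clampC k ((η : UnitAddTorus (Fin N × Fin 3) → ℂ) t) - (η : UnitAddTorus (Fin N × Fin 3) → ℂ) t)]
    · rw [lintegral_const_mul' _ _ ENNReal.ofReal_ne_top]
      exact ENNReal.mul_ne_top ENNReal.ofReal_ne_top (norm_Lp_two_sq_eq_toReal η).2
    · filter_upwards [hcoe] with t ht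
      simp only [Pi.sub_apply, ht]
      have h0 : (0 : ℝ≥0∞) = ‖(0 : ℂ)‖ₑ ^ (2 : ℝ) := by simp
      rw [h0]
      refine (ENNReal.continuous_rpow_const.tendsto _).comp ((continuous_enorm.tendsto _).comp ?_)
      have := (tendsto_clampC ((η : UnitAddTorus (Fin N × Fin 3) → ℂ) t)).sub_const ((η : UnitAddTorus (Fin N × Fin 3) → ℂ) t)
      rwa [sub_self] at this
  have hexp : ∀ k : ℕ, eLpNorm ((((lipschitzWith_clampC (k : ℝ)).compLp (clampC_zero (Nat.cast_nonneg k)) η :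
      L2T N) : UnitAddTorus (Fin N × Fin 3) → ℂ) - (η : UnitAddTorus (Fin N × Fin 3) → ℂ)) 2 volume =
      (∫⁻ t, ‖((((lipschitzWith_clampC (k : ℝ)).compLp (clampC_zero (Nat.cast_nonneg k)) η :
        L2T N) : UnitAddTorus (Fin N × Fin 3) → ℂ) - (η : UnitAddTorus (Fin N × Fin 3) → ℂ)) t‖ₑ ^ (2 : ℝ)) ^ (1 / (2 : ℝ)) :=
    fun k => by
      rw [eLpNorm_eq_lintegral_rpow_enorm_toReal two_ne_zero ENNReal.ofNat_ne_top, ENNReal.toReal_ofNat]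
  simp only [hexp]
  have h0 : (0 : ℝ≥0∞) = (0 : ℝ≥0∞) ^ (1 / (2 : ℝ)) := (ENNReal.zero_rpow_of_pos (by norm_num)).symm
  rw [h0]
  exact (ENNReal.continuous_rpow_const.tendsto _).comp hlin

/-! ### Approximation by Bose-symmetric trigonometric polynomials in the maximal form -/

/-- **Every Bose-symmetric class is approximated in the maximal form by Bose-symmetric trigonometric
polynomials** (integrable interaction): for `η ∈ L²((ℝ/ℤ)^{3N})` Bose-symmetric in momentum space and `ε > 0`
there is `P = ∑_{n ∈ S} aₙ eₙ` (`S` stable under the particle permutations, `a` invariant) with spectral kinetic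
energy at most that of `η`, `∫ (W ∘ fromUnitTorusN L)|P|² ≤ ∫ (W ∘ fromUnitTorusN L)|η|² + ε` and
`‖P - η‖ ≤ ε`. [cite: ReedSimonIV1978, Thm. XIII.64] -/
theorem exists_symm_trigPoly_maxForm_approx_general (hL : 0 < L) {w : ℝ → ℝ≥0∞} (hw : Measurable w)
    (hWint : ∫⁻ X in cellN N L, periodicInteraction w L X ≠ ⊤) (η : L2T N)
    (hsymm : ∀ (σ : Equiv.Perm (Fin N)) (n : Fin N × Fin 3 → ℤ),
      ⟪(mFourierLp 2 (fun p : Fin N × Fin 3 => n (σ p.1, p.2)) : L2T N), η⟫_ℂ = ⟪(mFourierLp 2 n : L2T N), η⟫_ℂ)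
    {ε : ℝ} (hε : 0 < ε) :
    ∃ (S : Finset (Fin N × Fin 3 → ℤ)) (a : (Fin N × Fin 3 → ℤ) → ℂ),
      (∀ (σ : Equiv.Perm (Fin N)) (n : Fin N × Fin 3 → ℤ), n ∈ S → (fun p => n (σ p.1, p.2)) ∈ S) ∧
      (∀ (σ : Equiv.Perm (Fin N)) (n : Fin N × Fin 3 → ℤ), a (fun p => n (σ p.1, p.2)) = a n) ∧
      (∑' n : Fin N × Fin 3 → ℤ, ENNReal.ofReal (∑ p, (2 * Real.pi * (n p : ℝ) / L) ^ 2) *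
          (‖⟪(mFourierLp 2 n : L2T N), ∑ m ∈ S, a m • (mFourierLp 2 m : L2T N)⟫_ℂ‖₊ : ℝ≥0∞) ^ 2 ≤
        ∑' n : Fin N × Fin 3 → ℤ, ENNReal.ofReal (∑ p, (2 * Real.pi * (n p : ℝ) / L) ^ 2) *
          (‖⟪(mFourierLp 2 n : L2T N), η⟫_ℂ‖₊ : ℝ≥0∞) ^ 2) ∧
      (∫⁻ t, periodicInteraction w L (fromUnitTorusN L t) *
          (‖((∑ m ∈ S, a m • (mFourierLp 2 m : L2T N) : L2T N) : UnitAddTorus (Fin N × Fin 3) → ℂ) t‖₊ : ℝ≥0∞) ^ 2 ≤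
        (∫⁻ t, periodicInteraction w L (fromUnitTorusN L t) *
          (‖(η : UnitAddTorus (Fin N × Fin 3) → ℂ) t‖₊ : ℝ≥0∞) ^ 2) + ENNReal.ofReal ε) ∧
      ‖(∑ m ∈ S, a m • (mFourierLp 2 m : L2T N)) - η‖ ≤ ε := by
  -- a truncation `f = clampC k ∘ η` within `ε/2` of `η`
  have hε2 : 0 < ε / 2 := half_pos hε
  obtain ⟨k, hk⟩ := ((tendsto_iff_norm_sub_tendsto_zero.1 (tendsto_clampLp η)).eventually (Iic_mem_nhds hε2)).exists
  set f : L2T N := (lipschitzWith_clampC (k : ℝ)).compLp (clampC_zero (Nat.cast_nonneg k)) η with hf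
  -- the bounded case for `f`
  obtain ⟨S, a, hS, ha, hkin, hpot, hdist⟩ := exists_symm_trigPoly_maxForm_approx hL hw hWint f
    (ae_norm_clampLp_le η k) (inner_symm_clampLp η k hsymm) hε2
  refine ⟨S, a, hS, ha, hkin.trans (tsum_kinetic_clampLp_le η k), ?_, ?_⟩
  · refine hpot.trans ((add_le_add (lintegral_pot_clampLp_le η k _) le_rfl).trans ?_)
    exact add_le_add le_rfl (ENNReal.ofReal_le_ofReal (by linarith))
  · calc ‖(∑ m ∈ S, a m • (mFourierLp 2 m : L2T N)) - η‖
        ≤ ‖(∑ m ∈ S, a m • (mFourierLp 2 m : L2T N)) - f‖ + ‖f - η‖ := norm_sub_le_norm_sub_add_norm_sub _ _ _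
      _ ≤ ε / 2 + ε / 2 := add_le_add hdist hk
      _ = ε := add_halves ε

/-! ### MaxFormApproximation: normalised core states -/

/-- The elementary inequality `(1 - e)⁻² ≤ 1 + 6e` for `0 ≤ e ≤ 1/4`. [folklore] -/
theorem inv_sq_one_sub_le {e : ℝ} (h0 : 0 ≤ e) (h1 : e ≤ 1 / 4) : ((1 - e) ^ 2)⁻¹ ≤ 1 + 6 * e := by
  rw [inv_le_iff_one_le_mul₀ (by nlinarith)]
  nlinarith [mul_nonneg h0 h0, mul_nonneg (mul_nonneg h0 h0) h0]

/-- **MaxFormApproximation (integrable interaction).** For `L > 0`, measurable `w` with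
`∫_{[0,L)^{3N}} W < ∞`, a UNIT `η ∈ L²((ℝ/ℤ)^{3N})` Bose-symmetric in momentum space with finite maximal-form
energy `Q_w(η)`, and `ε > 0`, there is a periodic `C¹` Bose trial state `Φ` with
`periodicEnergy w Φ ≤ Q_w(η) + ε` and `‖ι(graphEmbed Φ) - η‖ ≤ ε`, for the embedding `ι` of
`PeriodicFormDomain` built with any auxiliary admissible `(v, hv, hW)` (e.g. `v = 0`).
[cite: ReedSimonIV1978, Thm. XIII.64] -/
theorem exists_trialState_maxForm_approx (hL : 0 < L) {v : ℝ → ℝ≥0∞} (hv : Measurable v)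
    (hW : ∫⁻ X in cellN N L, periodicInteraction v L X ≠ ⊤) {w : ℝ → ℝ≥0∞} (hw : Measurable w)
    (hWint : ∫⁻ X in cellN N L, periodicInteraction w L X ≠ ⊤) (η : L2T N) (hη : ‖η‖ = 1)
    (hsymm : ∀ (σ : Equiv.Perm (Fin N)) (n : Fin N × Fin 3 → ℤ),
      ⟪(mFourierLp 2 (fun p : Fin N × Fin 3 => n (σ p.1, p.2)) : L2T N), η⟫_ℂ = ⟪(mFourierLp 2 n : L2T N), η⟫_ℂ)
    (hfin : (∑' n : Fin N × Fin 3 → ℤ, ENNReal.ofReal (∑ p, (2 * Real.pi * (n p : ℝ) / L) ^ 2) *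
          (‖⟪(mFourierLp 2 n : L2T N), η⟫_ℂ‖₊ : ℝ≥0∞) ^ 2 +
        ∫⁻ t, periodicInteraction w L (fromUnitTorusN L t) *
          (‖(η : UnitAddTorus (Fin N × Fin 3) → ℂ) t‖₊ : ℝ≥0∞) ^ 2) ≠ ⊤)
    {ε : ℝ} (hε : 0 < ε) :
    ∃ Φ : PeriodicTrialState N L,
      periodicEnergy w Φ ≤
        (∑' n : Fin N × Fin 3 → ℤ, ENNReal.ofReal (∑ p, (2 * Real.pi * (n p : ℝ) / L) ^ 2) *
            (‖⟪(mFourierLp 2 n : L2T N), η⟫_ℂ‖₊ : ℝ≥0∞) ^ 2 +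
          ∫⁻ t, periodicInteraction w L (fromUnitTorusN L t) *
            (‖(η : UnitAddTorus (Fin N × Fin 3) → ℂ) t‖₊ : ℝ≥0∞) ^ 2) + ENNReal.ofReal ε ∧
      ‖formEmbed hL hv hW ⟨graphEmbed hL hv hW ⟨Φ.ψ, Φ.mem_periodicCore⟩, graphEmbed_mem_formDomain hL hv hW _⟩ - η‖ ≤ ε := by
  -- notation
  set Q : ℝ≥0∞ := ∑' n : Fin N × Fin 3 → ℤ, ENNReal.ofReal (∑ p, (2 * Real.pi * (n p : ℝ) / L) ^ 2) *
      (‖⟪(mFourierLp 2 n : L2T N), η⟫_ℂ‖₊ : ℝ≥0∞) ^ 2 +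
    ∫⁻ t, periodicInteraction w L (fromUnitTorusN L t) * (‖(η : UnitAddTorus (Fin N × Fin 3) → ℂ) t‖₊ : ℝ≥0∞) ^ 2
    with hQdef
  set q : ℝ := Q.toReal with hqdef
  have hq0 : 0 ≤ q := ENNReal.toReal_nonneg
  have hQq : Q = ENNReal.ofReal q := (ENNReal.ofReal_toReal hfin).symm
  -- the accuracy `e = min (1/4) (ε / (6q + 3))`
  set e : ℝ := min (1 / 4) (ε / (6 * q + 3)) with hedef
  have he0 : 0 < e := lt_min (by norm_num) (by positivity)
  have he4 : e ≤ 1 / 4 := min_le_left _ _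
  have heε : e * (6 * q + 3) ≤ ε := by
    have h := min_le_right (1 / 4) (ε / (6 * q + 3))
    rw [← hedef] at h
    have h63 : 0 < 6 * q + 3 := by positivity
    calc e * (6 * q + 3) ≤ ε / (6 * q + 3) * (6 * q + 3) := mul_le_mul_of_nonneg_right h h63.le
      _ = ε := div_mul_cancel₀ ε h63.ne'
  have he2 : 2 * e ≤ ε := by nlinarith
  -- the trigonometric polynomial `P` at accuracy `e`
  obtain ⟨S, a, hS, ha, hkin, hpot, hdist⟩ := exists_symm_trigPoly_maxForm_approx_general hL hw hWint η hsymm he0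
  set P : L2T N := ∑ m ∈ S, a m • (mFourierLp 2 m : L2T N) with hPdef
  have hQP : (∑' n : Fin N × Fin 3 → ℤ, ENNReal.ofReal (∑ p, (2 * Real.pi * (n p : ℝ) / L) ^ 2) *
        (‖⟪(mFourierLp 2 n : L2T N), P⟫_ℂ‖₊ : ℝ≥0∞) ^ 2 +
      ∫⁻ t, periodicInteraction w L (fromUnitTorusN L t) * (‖(P : UnitAddTorus (Fin N × Fin 3) → ℂ) t‖₊ : ℝ≥0∞) ^ 2) ≤
      Q + ENNReal.ofReal e := by
    calc _ ≤ _ := add_le_add hkin hpot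
      _ = Q + ENNReal.ofReal e := (add_assoc _ _ _).symm
  -- `‖P‖` is close to `1`
  have hPnorm : |‖P‖ - 1| ≤ e := by
    rw [← hη]
    exact (abs_norm_sub_norm_le P η).trans hdist
  have hPpos : 0 < ‖P‖ := by
    have := (abs_le.1 hPnorm).1
    linarith
  have hPne : P ≠ 0 := norm_ne_zero_iff.1 hPpos.ne'
  -- `P` is an embedded core function; normalise it
  obtain ⟨Ψ, hΨ⟩ := exists_core_formEmbed_eq_sum_smul hL hv hW hS ha
  rw [← hPdef] at hΨ
  set c : ℝ := ‖P‖⁻¹ with hcdef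
  have hc0 : 0 < c := inv_pos.2 hPpos
  set Φc : periodicCore N L := ((c : ℝ) : ℂ) • Ψ with hΦc
  have hιΦ : formEmbed hL hv hW ⟨graphEmbed hL hv hW Φc, graphEmbed_mem_formDomain hL hv hW Φc⟩ = ((c : ℝ) : ℂ) • P := by
    rw [← hΨ, ← map_smul]
    congr 1
    apply Subtype.ext
    simp only [hΦc, map_smul, SetLike.mk_smul_mk]
  have h1 : ‖formEmbed hL hv hW ⟨graphEmbed hL hv hW Φc, graphEmbed_mem_formDomain hL hv hW Φc⟩‖ = 1 := by
    rw [hιΦ, norm_smul, Complex.norm_real, Real.norm_of_nonneg hc0.le, hcdef, inv_mul_cancel₀ hPpos.ne']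
  refine ⟨PeriodicTrialState.ofCore hL hv hW Φc h1, ?_, ?_⟩
  · -- the energy
    rw [periodicEnergy_eq_maxForm hL hv hW hw]
    have hcore : (⟨(PeriodicTrialState.ofCore hL hv hW Φc h1).ψ,
        (PeriodicTrialState.ofCore hL hv hW Φc h1).mem_periodicCore⟩ : periodicCore N L) = Φc := rfl
    rw [hcore, hιΦ, tsum_weight_inner_smul, lintegral_weight_smul_sq, ← mul_add, Complex.norm_real,
      Real.norm_of_nonneg hc0.le]
    -- `c² (Q + e) ≤ (1 + 6e)(q + e) ≤ q + ε`
    have hc2 : c ^ 2 ≤ 1 + 6 * e := by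
      have hle : 1 - e ≤ ‖P‖ := by linarith [(abs_le.1 hPnorm).1]
      have h1e : 0 < 1 - e := by linarith
      calc c ^ 2 = (‖P‖ ^ 2)⁻¹ := by rw [hcdef, inv_pow]
        _ ≤ ((1 - e) ^ 2)⁻¹ := by
            refine inv_anti₀ (by positivity) ?_
            exact pow_le_pow_left₀ h1e.le hle 2
        _ ≤ 1 + 6 * e := inv_sq_one_sub_le he0.le he4
    calc ENNReal.ofReal (c ^ 2) * _ ≤ ENNReal.ofReal (1 + 6 * e) * (Q + ENNReal.ofReal e) :=
          mul_le_mul' (ENNReal.ofReal_le_ofReal hc2) hQP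
      _ = ENNReal.ofReal ((1 + 6 * e) * (q + e)) := by
          rw [hQq, ← ENNReal.ofReal_add hq0 he0.le, ← ENNReal.ofReal_mul (by linarith)]
      _ ≤ ENNReal.ofReal (q + ε) := by
          refine ENNReal.ofReal_le_ofReal ?_
          nlinarith [mul_nonneg he0.le hq0]
      _ = Q + ENNReal.ofReal ε := by rw [ENNReal.ofReal_add hq0 hε.le, ← hQq]
  · -- the distance
    have hcore : (⟨(PeriodicTrialState.ofCore hL hv hW Φc h1).ψ,
        (PeriodicTrialState.ofCore hL hv hW Φc h1).mem_periodicCore⟩ : periodicCore N L) = Φc := rfl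
    rw [hcore, hιΦ]
    calc ‖((c : ℝ) : ℂ) • P - η‖ ≤ ‖((c : ℝ) : ℂ) • P - P‖ + ‖P - η‖ := norm_sub_le_norm_sub_add_norm_sub _ _ _
      _ = |c - 1| * ‖P‖ + ‖P - η‖ := by
          rw [show ((c : ℝ) : ℂ) • P - P = (((c - 1 : ℝ)) : ℂ) • P by
            rw [Complex.ofReal_sub, Complex.ofReal_one, sub_smul, one_smul], norm_smul, Complex.norm_real,
            Real.norm_eq_abs]
      _ = |1 - ‖P‖| + ‖P - η‖ := by
          rw [hcdef, show ‖P‖⁻¹ - 1 = (1 - ‖P‖) * ‖P‖⁻¹ by field_simp, abs_mul, abs_of_pos (inv_pos.2 hPpos),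
            mul_assoc, inv_mul_cancel₀ hPpos.ne', mul_one]
      _ ≤ e + e := add_le_add (by rw [abs_sub_comm]; exact hPnorm) hdist
      _ ≤ ε := by linarith

end Literature.MathematicalPhysics.QuantumManyBody.BoseGas

end
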